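import Literature.Geometry.Symplectic.CanonicalClass
import Literature.Geometry.Symplectic.AlmostComplexTangentBundleIso
import Literature.AlgebraicTopology.CharacteristicClasses.FramedBundleTrivial
import Literature.AlgebraicTopology.SingularHomology.FinitePunctureCohomology
import HarnessLib

/-!
# The Chern classes of an almost complex manifold die where `(TM, J)` is complex-framed;
# `c₁(TN, J) = 0` for a manifold of dimension `≥ 3` complex-framed off a finite set

Topic `Literature/Geometry/Symplectic`. Milnor–Stasheff, *Characteristic Classes* (1974): §2
Thm. 2.2 (independent cross-sections trivialise a bundle), §14 (Chern classes; Lemma 14.3 /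
naturality and `c(εⁿ) = 1`); Hatcher, *Algebraic Topology* (2002), §3.3 p. 231 (the local
cohomology of a finite set in a `d`-manifold is concentrated in degree `d`). For an almost complex
manifold `(M, J)` (`AlmostComplexStructure.lean`; Chern classes `J.chernClass i = cᵢ(TM, J)` of
`CanonicalClass.lean`, built on Grothendieck's integral classes `chernClassZ`):

* `linearIndependent_complex_of_real_frame`, `top_le_span_complex_of_real_frame` — linear algebra:
  if `φ : W ≃ V` is real-linear from a complex vector space with `φ(i z) = J φ(z)`, and the vectors
  `v₁, …, v_r, J v₁, …, J v_r` form a real basis of `V`, then `φ⁻¹ v₁, …, φ⁻¹ v_r` form a complex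
  basis of `W`;
* `map_chernClass_eq_zero_of_complexFrame` — if along a map `f : S → M` there are tangent vector
  fields `s₁, …, s_r` (continuous into `TM`) such that `(sᵢ, J sᵢ)ᵢ` is a real basis of every
  `T_{f p} M`, then `f^* cᵢ(TM, J) = 0` for `i > 0` (the pulled-back complex tangent bundle is
  framed by the `sᵢ`, hence trivial: `ComplexVectorBundle.chernClassZ_eq_zero_of_frame`, and
  (C₁) naturality);
* `firstChernClass_eq_zero_of_complexFrame_compl_finite` — on a Hausdorff second countable
  `d`-manifold `N`, `d ≥ 3`, complex-framed in this sense off a finite set `F`,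
  `c₁(TN, J) = 0 ∈ H²(N; ℤ)` (restriction `H²(N) → H²(N ∖ F)` is injective,
  `map_inclusion_injective_of_finite_diff`).

Everything is proved; no definitions, no named facts.

## References

* J. Milnor, J. Stasheff, *Characteristic Classes*, Ann. of Math. Studies 76 (1974), §2 Thm. 2.2,
  §14 Lemma 14.3. [MilnorStasheff1974]
* A. Hatcher, *Algebraic Topology*, CUP (2002), §3.3 p. 231. [HatcherAT2002]
* D. McDuff, D. Salamon, *Introduction to Symplectic Topology*, 3rd ed. (2017), Rem. 2.7.2.
  [McDuffSalamon2017]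
-/

noncomputable section

open scoped Manifold ContDiff Topology
open Bundle Set Function Filter Module
open Literature.AlgebraicTopology.CharacteristicClasses Literature.AlgebraicTopology.SingularHomology

namespace Literature.Geometry.Symplectic

namespace AlmostComplexStructure

/-! ### Linear algebra: a complex basis from a real `J`-adapted frame -/

section LinearAlgebra

variable {W V : Type*} [AddCommGroup W] [Module ℂ W] [Module ℝ W] [IsScalarTower ℝ ℂ W]
  [AddCommGroup V] [Module ℝ V] {ι : Type*} [Fintype ι]

/-- `c • w = (re c) • w + (im c) • (i • w)` for compatible real and complex structures. [folklore] -/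
theorem complex_smul_eq_re_add_im (c : ℂ) (w : W) :
    c • w = c.re • w + c.im • ((Complex.I : ℂ) • w) := by
  have h1 : (c.re : ℂ) • w = c.re • w := by
    rw [← algebraMap_smul ℂ c.re w, Complex.coe_algebraMap]
  have h2 : (c.im : ℂ) • ((Complex.I : ℂ) • w) = c.im • ((Complex.I : ℂ) • w) := by
    rw [← algebraMap_smul ℂ c.im ((Complex.I : ℂ) • w), Complex.coe_algebraMap]
  conv_lhs => rw [← Complex.re_add_im c]
  rw [add_smul, mul_smul, h1, h2]

/-- **A real `J`-adapted frame is a complex frame, independence.** Let `φ : W → V` be a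
real-linear map from a complex vector space intertwining `i` with `J : V → V`, and `z₁, …, z_r ∈ W`
such that `φ z₁, …, φ z_r, J φ z₁, …, J φ z_r` are linearly independent over `ℝ`; then
`z₁, …, z_r` are linearly independent over `ℂ`. [folklore] -/
theorem linearIndependent_complex_of_real_frame (φ : W →ₗ[ℝ] V)
    (Jv : V →ₗ[ℝ] V) (hJ : ∀ z, φ ((Complex.I : ℂ) • z) = Jv (φ z)) (z : ι → W)
    (h : LinearIndependent ℝ (Sum.elim (fun i ↦ φ (z i)) (fun i ↦ Jv (φ (z i))))) :
    LinearIndependent ℂ z := by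
  rw [Fintype.linearIndependent_iff]
  intro g hg i
  rw [Fintype.linearIndependent_iff] at h
  have h0 : φ (∑ i, g i • z i) = 0 := by rw [hg, map_zero]
  have hexp : φ (∑ i, g i • z i) =
      ∑ j, Sum.elim (fun i ↦ (g i).re) (fun i ↦ (g i).im) j •
        Sum.elim (fun i ↦ φ (z i)) (fun i ↦ Jv (φ (z i))) j := by
    rw [Fintype.sum_sum_type]
    simp only [Sum.elim_inl, Sum.elim_inr, map_sum]
    rw [← Finset.sum_add_distrib]
    refine Finset.sum_congr rfl fun i _ ↦ ?_
    rw [complex_smul_eq_re_add_im (g i) (z i), map_add, map_smul, map_smul, hJ]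
  rw [hexp] at h0
  have hre := h _ h0 (Sum.inl i)
  have him := h _ h0 (Sum.inr i)
  simp only [Sum.elim_inl, Sum.elim_inr] at hre him
  exact Complex.ext hre him

/-- **A real `J`-adapted frame is a complex frame, spanning.** With `φ : W ≃ V` a real-linear
equivalence intertwining `i` with `J`, if `φ z₁, …, J φ z_r` span `V` over `ℝ` then `z₁, …, z_r`
span `W` over `ℂ`. [folklore] -/
theorem top_le_span_complex_of_real_frame (φ : W ≃ₗ[ℝ] V)
    (Jv : V →ₗ[ℝ] V) (hJ : ∀ z, φ ((Complex.I : ℂ) • z) = Jv (φ z)) (z : ι → W)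
    (h : ⊤ ≤ Submodule.span ℝ (range (Sum.elim (fun i ↦ φ (z i)) (fun i ↦ Jv (φ (z i)))))) :
    ⊤ ≤ Submodule.span ℂ (range z) := by
  intro w _
  have hw : φ w ∈ Submodule.span ℝ (range (Sum.elim (fun i ↦ φ (z i)) (fun i ↦ Jv (φ (z i))))) :=
    h Submodule.mem_top
  obtain ⟨c, hc⟩ := (Submodule.mem_span_range_iff_exists_fun ℝ).1 hw
  rw [Fintype.sum_sum_type] at hc
  simp only [Sum.elim_inl, Sum.elim_inr] at hc
  have hw' : w = ∑ i, ((c (Sum.inl i) : ℂ) + (c (Sum.inr i) : ℂ) * Complex.I) • z i := by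
    apply φ.injective
    rw [← hc, map_sum, ← Finset.sum_add_distrib]
    refine Finset.sum_congr rfl fun i _ ↦ ?_
    rw [complex_smul_eq_re_add_im, map_add, map_smul, map_smul, hJ]
    congr 2 <;> simp
  rw [hw']
  exact Submodule.sum_mem _ fun i _ ↦ Submodule.smul_mem _ _ (Submodule.subset_span ⟨i, rfl⟩)

end LinearAlgebra

/-! ### Complex frames along a map kill the pulled-back Chern classes -/

section Frame

variable {E : Type*} [NormedAddCommGroup E] [NormedSpace ℝ E] [FiniteDimensional ℝ E]
  {H : Type*} [TopologicalSpace H] {I : ModelWithCorners ℝ E H}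
  {M : Type} [TopologicalSpace M] [ChartedSpace H M] [IsManifold I 1 M] {n : WithTop ℕ∞}
  (J : AlmostComplexStructure I n M)
  {S : Type} [TopologicalSpace S] {ι : Type} [Fintype ι]

/-- **`f^* cᵢ(TM, J) = 0` when `(f^*TM, J)` has a complex frame.** Let `f : S → M` be continuous
and `s₁, …, s_r` tangent vector fields along `f` (`sᵢ p ∈ T_{f p} M`, continuous into `TM`) such
that `(s₁, …, s_r, J s₁, …, J s_r)` is a real basis of `T_{f p} M` at every `p`. Then
`f^* cᵢ(TM, J) = 0` for `0 < i` (over paracompact Hausdorff `S`, `M`): the `sᵢ` are a continuous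
`ℂ`-frame of the pulled-back complex tangent bundle `f^*(TM, J)`
(`AlmostComplexTangentBundleIso`: `(TM, J)` is `TM` as a topological space), which is therefore
trivial (Milnor–Stasheff §2 Thm. 2.2, `ComplexVectorBundle.chernClassZ_eq_zero_of_frame`), and
`c(f^*ξ) = f^* c(ξ)` (§14 Lemma 14.3, axiom (C₁)). [cite: MilnorStasheff1974, §2 Thm. 2.2 and §14 Lemma 14.3] -/
theorem map_chernClass_eq_zero_of_complexFrame [T2Space M] [ParacompactSpace M] [T2Space S]
    [ParacompactSpace S] (f : C(S, M)) (s : ι → S → E)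
    (hsc : ∀ i, Continuous fun p ↦ (⟨f p, s i p⟩ : TangentBundle I M))
    (hsb : ∀ p, LinearIndependent ℝ (Sum.elim (fun i ↦ s i p) (fun i ↦ J (f p) (s i p))) ∧
      ⊤ ≤ Submodule.span ℝ (range (Sum.elim (fun i ↦ s i p) (fun i ↦ J (f p) (s i p)))))
    {i : ℕ} (hi : 0 < i) :
    singularCohomology.map ℤ ℤ f (2 * i) (J.chernClass i) = 0 := by
  set E' : ComplexVectorBundle S := J.complexTangentBundle.pullback f with hE'
  -- the frame of the pulled-back complex tangent bundle
  let φ : ∀ x : M, J.complexTangentCore.Fiber x ≃L[ℝ] E := fun x ↦ J.complexTangentCore_fiberEquiv x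
  let σ : ι → (p : S) → E'.E p := fun i p ↦
    (show J.complexTangentCore.Fiber (f p) from (φ (f p)).symm (s i p))
  have hσc : ∀ i, Continuous fun p ↦ (⟨p, σ i p⟩ : TotalSpace E'.F E'.E) := by
    intro i
    refine ((inducing_pullbackTotalSpaceEmbedding (F := Fin (finrank ℝ E / 2) → ℂ)
      (E := J.complexTangentCore.Fiber) (f : S → M)).continuous_iff).2 ?_
    show Continuous fun p ↦ (p, J.tangentHomeomorph.symm ⟨f p, s i p⟩)
    exact continuous_id.prodMk (J.tangentHomeomorph.symm.continuous.comp (hsc i))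
  have hσb : ∀ p, LinearIndependent ℂ (fun i ↦ σ i p) ∧
      ⊤ ≤ Submodule.span ℂ (range fun i ↦ σ i p) := by
    intro p
    have hJ : ∀ z : J.complexTangentCore.Fiber (f p),
        (φ (f p)).toLinearEquiv ((Complex.I : ℂ) • z) = (J (f p)).toLinearMap ((φ (f p)).toLinearEquiv z) :=
      fun z ↦ J.complexTangentCore_fiberEquiv_I (f p) z
    have hfam : (Sum.elim (fun i ↦ s i p) (fun i ↦ J (f p) (s i p))) =
        Sum.elim (fun i ↦ (φ (f p)).toLinearEquiv (σ i p))
          (fun i ↦ (J (f p)).toLinearMap ((φ (f p)).toLinearEquiv (σ i p))) := by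
      funext j
      rcases j with i | i
      · simp [σ, φ]
      · simp [σ, φ]
    obtain ⟨hli, hsp⟩ := hsb p
    rw [hfam] at hli hsp
    exact ⟨linearIndependent_complex_of_real_frame (φ (f p)).toLinearEquiv.toLinearMap _ hJ _ hli,
      top_le_span_complex_of_real_frame (φ (f p)).toLinearEquiv _ hJ _ hsp⟩
  have h0 : chernClassZ E' i = 0 := ComplexVectorBundle.chernClassZ_eq_zero_of_frame E' σ hσc hσb hi
  have hnat := theChernClassTheory.chernClass_pullback f J.complexTangentBundle i
  change chernClassZ E' i = singularCohomology.map ℤ ℤ f (2 * i) (J.chernClass i) at hnat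
  rw [← hnat, h0]

end Frame

/-! ### Complex-framed off a finite set: `c₁ = 0` -/

section Finite

variable {d : ℕ} {N : Type} [TopologicalSpace N] [T2Space N] [SecondCountableTopology N]
  [ChartedSpace (EuclideanSpace ℝ (Fin d)) N] [IsManifold (𝓡 d) ∞ N] {n : WithTop ℕ∞}

/-- **`c₁(TN, J) = 0` for a manifold complex-framed off a finite set.** Let `N` be a Hausdorff
second countable `d`-manifold, `d ≥ 3`, with an almost complex structure `J`, and `F ⊆ N` finite
such that along `N ∖ F ↪ N` there are tangent vector fields `s₁, …, s_r` with
`(s₁, …, s_r, J s₁, …, J s_r)` a real basis of each tangent space. Then `c₁(TN, J) = 0` in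
`H²(N; ℤ)`: its restriction to `N ∖ F` vanishes (`map_chernClass_eq_zero_of_complexFrame`) and
`H²(N; ℤ) → H²(N ∖ F; ℤ)` is injective (Hatcher §3.3 p. 231,
`map_inclusion_injective_of_finite_diff`). [cite: MilnorStasheff1974, §2 Thm. 2.2 and §14 Lemma 14.3]
[cite: HatcherAT2002, §3.3 p. 231] -/
theorem firstChernClass_eq_zero_of_complexFrame_compl_finite (hd : 3 ≤ d)
    (J : AlmostComplexStructure (𝓡 d) n N) {F : Set N} (hF : F.Finite) {ι : Type} [Fintype ι]
    (s : ι → (Fᶜ : Set N) → EuclideanSpace ℝ (Fin d))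
    (hsc : ∀ i, Continuous fun p : (Fᶜ : Set N) ↦ (⟨(p : N), s i p⟩ : TangentBundle (𝓡 d) N))
    (hsb : ∀ p : (Fᶜ : Set N),
      LinearIndependent ℝ (Sum.elim (fun i ↦ s i p) (fun i ↦ J (p : N) (s i p))) ∧
      ⊤ ≤ Submodule.span ℝ (range (Sum.elim (fun i ↦ s i p) (fun i ↦ J (p : N) (s i p))))) :
    J.firstChernClass = 0 := by
  haveI : LocallyCompactSpace N := ChartedSpace.locallyCompactSpace (EuclideanSpace ℝ (Fin d)) N
  have hU : IsOpen (Fᶜ : Set N) := hF.isClosed.isOpen_compl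
  haveI : LocallyCompactSpace (Fᶜ : Set N) := hU.locallyCompactSpace
  set f : C((Fᶜ : Set N), N) := ⟨(↑), continuous_subtype_val⟩ with hf
  have h0 := map_chernClass_eq_zero_of_complexFrame J f s hsc hsb (i := 1) one_pos
  -- `H²(N) → H²(N ∖ F)` is injective
  have hsub : (Fᶜ : Set N) ⊆ univ := subset_univ _
  have hinj₁ : Injective (singularCohomology.map ℤ ℤ
      (ContinuousMap.inclusion hsub : C(↥(Fᶜ : Set N), ↥(univ : Set N))) (2 * 1)) :=
    map_inclusion_injective_of_finite_diff (d := d) (M := N) (by omega) isOpen_univ hsub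
      (by simpa using hF) (k := 2 * 1) (by norm_num) (by omega)
  let e : (univ : Set N) ≃ₜ N := Homeomorph.Set.univ N
  have hinj₂ : Injective (singularCohomology.map ℤ ℤ (e : C(↥(univ : Set N), N)) (2 * 1)) :=
    (singularCohomology.mapIso ℤ ℤ e (2 * 1)).toLinearEquiv.injective
  have hfe : f = (e : C(↥(univ : Set N), N)).comp (ContinuousMap.inclusion hsub) := by
    ext p; rfl
  rw [hfe, singularCohomology.map_comp] at h0
  have h1 : J.chernClass 1 = 0 := hinj₂ (hinj₁ (by simpa using h0))
  rw [firstChernClass_eq, h1, map_zero]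

end Finite

end AlmostComplexStructure

end Literature.Geometry.Symplectic

end
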